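import Summits.BirchSwinnertonDyer.Rank1Residual.Iwasawa.CyclotomicPrime
import Summits.BirchSwinnertonDyer.BirchSwinnertonDyer.Theorems.SignedLowerHalvesKobayashiLowerHalfSemistableDefectPrime
import HarnessLib

/-!
# Route `AlignedTransportAtTwo`, crux C2 `MainConjectureOfRankZeroBSDAtTwo` (stmt-BirchSwinnertonDyer-22298):
# THE LAYER CYCLOTOMIC PRIMES `Φ_{p^{n+1}}(1+T) ∈ Λ` AND `P^t ∣ char_Λ X` FROM `deg P · t` INDEPENDENT ELEMENTS MODULO `P·X`,
# FOR EVERY PRIME DISTINGUISHED POLYNOMIAL `P` (the algebra half of Greenberg's p. 132 argument AT EVERY LAYER)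

HONEST FRAMING (cell `bsd-f1-sign2`, WIDTH-5 attached prover seat `bsd-line-att-p5` gen 36 on line `birth` of the lead
`bsd-line-att-p2`; `--supports` stmt-BirchSwinnertonDyer-22298, closes nothing; BSD is NOT proved by any of this; the crux C2, its
verdict «blocked-on `Rank1Residual.GreenbergMuConjectureIrreducible`» and every registered stub are untouched). PURE COMMUTATIVE
ALGEBRA over `Λ = ℤ_p⟦T⟧` — THEOREMS ONLY (no `def`, no named fact, no `sorry`). This is the algebra half of the lineage's
successor item «layer-two cyclotomic divisibility» (g34 memo §4 (iii), g35 memo §6 (ii)): the tree's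
`Rank1Residual/Iwasawa/CyclotomicPrime.lean` treats ONLY the first layer `ξ_p = Φ_p(1+T)`; here the same three steps are run for
an ARBITRARY distinguished polynomial `P ∈ ℤ_p[X]` that is PRIME in `Λ`, and then specialised to the layer polynomials
`Φ_{p^{n+1}}(1+T)` (spelled `(((cyclotomic (p ^ (n+1)) ℤ_[p]).comp (X + 1) : ℤ_[p][X]) : Λ)`, the tree's reading of
`LambdaInvariantZeros` / `PlusMinusPAdicLFunction`; NO new definition is introduced).

* §1 GENERAL PRIME DISTINGUISHED `P`. `isPrime_span_coe` / `height_span_coe` (`(P) ⊂ Λ` is a height-one prime);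
  `coe_pow_dvd_of_mem_charIdeal_of_le_lengthAt` (**`g ∈ char_Λ X ⇒ P^t ∣ g` for `t ≤ length_{Λ_(P)} X_(P)`**);
  `natCast_le_lengthAt_of_linearIndependent_coe` (**`t` elements of `X/P·X` independent over `𝒪 = Λ/(P)` ⇒ `t ≤ length`**);
  ★ `coe_pow_dvd_of_mem_charIdeal_of_indep` — **for a finitely generated torsion `Λ`-module `X` and `x_1, …, x_m ∈ X` with
  «`∑ c_k x_k ∈ P·X` (`c_k ∈ ℤ_p`) only for `c = 0`» and `deg P · t ≤ m`: `P^t ∣ g` for every `g ∈ char_Λ X`** (rank conversion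
  `ℤ_p ↝ 𝒪`, `𝒪` free of rank `deg P`, the tree's `RankConversion`). The tree's `xi_pow_dvd_of_mem_charIdeal_of_indep` is `P = ξ_p`.
* §2 THE LAYER POLYNOMIALS `Ψ_n := Φ_{p^{n+1}}(1+T)` (`n ≥ 0`; `Ψ_0 = ξ_p`). Distinguished, PRIME in `ℤ_p[X]` and in `Λ`, `μ = 0`,
  `λ = φ(p^{n+1})`, constant term `p` are ALREADY in the tree (cell bsd-ssimc's `Theorems/…DefectPrime`:
  `cyclotomic_comp_isDistinguishedAt_maximalIdeal`, `prime_cyclotomic_comp_polynomial`, `prime_coe_cyclotomic_comp`,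
  `mu_coe_cyclotomic_comp`, `lam_coe_cyclotomic_comp`, `constantCoeff_coe_cyclotomic_comp`) and are REUSED, not restated; added here:
  `λ(Ψ_n) = pⁿ(p−1)` as a product, `‖Ψ_n(0)‖ = p⁻¹`, height one, `Ψ_n = ∑_{i<p} ((1+T)^{pⁿ})^i` (Mathlib
  `cyclotomic_prime_pow_eq_geom_sum`), `Ψ_n · ω_n = ω_{n+1}` (`ω_n = (1+T)^{pⁿ} − 1`; Mathlib `cyclotomic_prime_pow_mul_X_pow_sub_one`),
  `Ψ_0 = ξ_p`, and `Λ/(Ψ_n)` free of rank `pⁿ(p−1)` over `ℤ_p`.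
* §3 ★★ `cyclotomicLayer_pow_dvd_of_mem_charIdeal_of_indep` — §1 for `P = Ψ_n` (prime by `DefectPrime.prime_coe_cyclotomic_comp`): **`pⁿ(p−1)·t` elements of `X` that are
  `ℤ_p`-independent modulo `Ψ_n·X` put `Ψ_n^t` into `char_Λ X`.** The arithmetic half (the relative norm `E(K_{n+1}) → E(K_n)` and the
  Kummer classes of the layer `K_{n+1}`) is the companion file `…CyclotomicLayerRankGrowth`.

References: R. Greenberg, LNM 1716 (1999), §5 p. 132 (conductor 34 at `p = 3`: «`θ_1^t` divides `f_E(T)`») and Thm. 1.9 (p. 63)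
[GreenbergLNM1716]; L. Washington, GTM 83, Prop. 7.2 / Thm. 7.3 / §13.2 (structure of `Λ`-modules, distinguished polynomials)
[Washington1997]; N. Bourbaki, AC VII §4.4 (lengths at height-one primes).
-/

set_option linter.dupNamespace false
set_option autoImplicit false

noncomputable section

open scoped Classical Polynomial

namespace Summit.BirchSwinnertonDyer.BirchSwinnertonDyer.Theorems.AlignedTransportAtTwoCyclotomicLayerPrime

open Polynomial Literature.NumberTheory.EllipticCurves
  Summit.BirchSwinnertonDyer.Rank1Residual.X1.MuLambda
  Summit.BirchSwinnertonDyer.Rank1Residual.X1.CyclotomicZeros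
  Summit.BirchSwinnertonDyer.Rank1Residual.Iwasawa
  Summit.BirchSwinnertonDyer.BirchSwinnertonDyer.Theorems.DefectPrime

universe u

variable {p : ℕ} [hp : Fact p.Prime]

/-! ## §1 A prime distinguished polynomial `P`: `(P) ⊂ Λ` is a height-one prime, and `P^t ∣ char_Λ X` from independent elements -/

section General

variable {P : ℤ_[p][X]} (hP : P.IsDistinguishedAt (IsLocalRing.maximalIdeal ℤ_[p]))
  (hPr : Prime (P : PowerSeries ℤ_[p]))

include hPr in
/-- `(P) ⊂ Λ` is a prime ideal for `P` prime in `Λ`. [folklore] -/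
theorem isPrime_span_coe : (Ideal.span {(P : PowerSeries ℤ_[p])}).IsPrime :=
  (Ideal.span_singleton_prime hPr.ne_zero).mpr hPr

include hPr in
/-- `(P) ⊂ Λ` has height one (nonzero principal prime of the Noetherian domain `Λ`; Krull). [folklore] -/
theorem height_span_coe : (Ideal.span {(P : PowerSeries ℤ_[p])}).height = 1 :=
  Ideal.height_span_singleton_eq_one_of_mem_nonZeroDivisors
    (mem_nonZeroDivisors_of_ne_zero hPr.ne_zero) hPr.not_unit

variable (𝔭 : PrimeSpectrum (IwasawaAlgebra p)) (h𝔭 : 𝔭.asIdeal = Ideal.span {(P : PowerSeries ℤ_[p])})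

include hPr h𝔭 in
/-- **`g ∈ char_Λ X ⇒ P^t ∣ g` whenever `t ≤ length_{Λ_(P)} X_(P)`** (`X` finitely generated and torsion, `P` prime in `Λ`):
`char_Λ X = ∏_{ht 𝔮 = 1} 𝔮^{ℓ_𝔮}` is a genuine finite product containing the factor `(P)^ℓ`, `ℓ = ℓ_{(P)}(X) < ∞`. The tree's
`xi_pow_dvd_of_mem_charIdeal_of_le_lengthAt` is `P = ξ_p`. [cite: Washington1997, §13.2] -/
theorem coe_pow_dvd_of_mem_charIdeal_of_le_lengthAt (X : Type u) [AddCommGroup X]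
    [Module (IwasawaAlgebra p) X] [Module.Finite (IwasawaAlgebra p) X]
    (hX : Module.IsTorsion (IwasawaAlgebra p) X) {g : IwasawaAlgebra p}
    (hg : g ∈ Module.charIdeal (IwasawaAlgebra p) X) {t : ℕ}
    (ht : (t : ℕ∞) ≤ Module.lengthAt (IwasawaAlgebra p) X 𝔭) : (P : PowerSeries ℤ_[p]) ^ t ∣ g := by
  obtain ⟨s, hs, hs0⟩ := Submodule.annihilator_top_inter_nonZeroDivisors hX
  have hsX : ∀ m : X, s • m = 0 := fun m ↦ Submodule.mem_annihilator.mp hs m Submodule.mem_top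
  have hht : 𝔭.asIdeal.height = 1 := by rw [h𝔭]; exact height_span_coe hPr
  have hne : Module.lengthAt (IwasawaAlgebra p) X 𝔭 ≠ ⊤ :=
    Module.lengthAt_ne_top_of_isTorsionBy (nonZeroDivisors.ne_zero hs0) (fun m ↦ hsX m) _ hht.le
  rw [← ENat.coe_toNat hne] at ht
  set l := (Module.lengthAt (IwasawaAlgebra p) X 𝔭).toNat with hl
  have hfin : (Function.mulSupport fun 𝔮 : PrimeSpectrum (IwasawaAlgebra p) ↦
      ({𝔮 | 𝔮.asIdeal.height = 1} : Set (PrimeSpectrum (IwasawaAlgebra p))).mulIndicator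
        (fun 𝔮 ↦ 𝔮.asIdeal ^ (Module.lengthAt (IwasawaAlgebra p) X 𝔮).toNat) 𝔮).Finite := by
    rw [Set.mulSupport_mulIndicator]
    exact Module.finite_heightOne_inter_mulSupport (nonZeroDivisors.ne_zero hs0) fun m ↦ hsX m
  have hle : Module.charIdeal (IwasawaAlgebra p) X ≤ 𝔭.asIdeal ^ l := by
    apply Ideal.le_of_dvd
    unfold Module.charIdeal
    rw [finprod_mem_def]
    have h := finprod_mem_dvd 𝔭 hfin
    rwa [Set.mulIndicator_of_mem (show 𝔭 ∈
      ({𝔮 | 𝔮.asIdeal.height = 1} : Set (PrimeSpectrum (IwasawaAlgebra p))) from hht)] at h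
  have hmem : g ∈ Ideal.span {(P : PowerSeries ℤ_[p]) ^ l} := by
    rw [← Ideal.span_singleton_pow, ← h𝔭]
    exact hle hg
  exact (pow_dvd_pow _ (by exact_mod_cast ht)).trans (Ideal.mem_span_singleton.mp hmem)

include h𝔭 in
/-- `(Λ/(P))_{(P)} ≠ 0` (the residue field of `Λ_{(P)}`): `(P) ⊇ Ann_Λ Λ/(P)`. [folklore] -/
theorem nontrivial_localizedModule_quotient_coe :
    Nontrivial (LocalizedModule 𝔭.asIdeal.primeCompl
      (IwasawaAlgebra p ⧸ Ideal.span {(P : PowerSeries ℤ_[p])})) :=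
  Module.mem_support_iff.mp
    (Module.mem_support_iff_of_finite.mpr (by rw [Ideal.annihilator_quotient, h𝔭]))

include h𝔭 in
/-- **`t ≤ length_{Λ_(P)} X_(P)` if `X/P·X` has `t` elements independent over `𝒪 = Λ/(P)`** (they span an injective `Λ`-linear map
`𝒪^{⊕ t} → X/P·X`; localisation at `𝔭 = (P)` is exact; `(𝒪_𝔭)^{⊕ t}` has length `≥ t`; `X ↠ X/P·X`). The tree's
`natCast_le_lengthAt_of_linearIndependent` is `P = ξ_p`. [cite: Washington1997, §13.2] -/
theorem natCast_le_lengthAt_of_linearIndependent_coe (X : Type u) [AddCommGroup X]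
    [Module (IwasawaAlgebra p) X] {t : ℕ}
    {y : Fin t → X ⧸ (Ideal.span {(P : PowerSeries ℤ_[p])} • ⊤ : Submodule (IwasawaAlgebra p) X)}
    (hy : LinearIndependent (IwasawaAlgebra p ⧸ Ideal.span {(P : PowerSeries ℤ_[p])}) y) :
    (t : ℕ∞) ≤ Module.lengthAt (IwasawaAlgebra p) X 𝔭 := by
  have hΦ : Function.Injective ((Finsupp.linearCombination
      (IwasawaAlgebra p ⧸ Ideal.span {(P : PowerSeries ℤ_[p])}) y).restrictScalars (IwasawaAlgebra p)) := by
    rw [LinearMap.coe_restrictScalars]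
    exact hy
  have hFY := length_localizedModule_le_of_injective 𝔭 _ hΦ
  have hF : Module.length (Localization.AtPrime 𝔭.asIdeal)
      (LocalizedModule 𝔭.asIdeal.primeCompl (Fin t →₀
        (IwasawaAlgebra p ⧸ Ideal.span {(P : PowerSeries ℤ_[p])}))) =
      Module.length (Localization.AtPrime 𝔭.asIdeal)
        (Fin t →₀ LocalizedModule 𝔭.asIdeal.primeCompl
          (IwasawaAlgebra p ⧸ Ideal.span {(P : PowerSeries ℤ_[p])})) :=
    LinearEquiv.length_eq
      ((IsLocalizedModule.iso 𝔭.asIdeal.primeCompl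
        (Finsupp.mapRange.linearMap (α := Fin t)
          (LocalizedModule.mkLinearMap 𝔭.asIdeal.primeCompl
            (IwasawaAlgebra p ⧸ Ideal.span {(P : PowerSeries ℤ_[p])})))
        ).extendScalarsOfIsLocalization 𝔭.asIdeal.primeCompl
          (Localization.AtPrime 𝔭.asIdeal))
  have hC : Module.length (Localization.AtPrime 𝔭.asIdeal)
      (Fin t →₀ LocalizedModule 𝔭.asIdeal.primeCompl
        (IwasawaAlgebra p ⧸ Ideal.span {(P : PowerSeries ℤ_[p])})) =
      t * Module.length (Localization.AtPrime 𝔭.asIdeal)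
        (LocalizedModule 𝔭.asIdeal.primeCompl
          (IwasawaAlgebra p ⧸ Ideal.span {(P : PowerSeries ℤ_[p])})) := by
    rw [Module.length_finsupp, ENat.card_eq_coe_fintype_card, Fintype.card_fin]
  rw [hF, hC] at hFY
  have hk : (1 : ℕ∞) ≤ Module.length (Localization.AtPrime 𝔭.asIdeal)
      (LocalizedModule 𝔭.asIdeal.primeCompl
        (IwasawaAlgebra p ⧸ Ideal.span {(P : PowerSeries ℤ_[p])})) := by
    haveI := nontrivial_localizedModule_quotient_coe 𝔭 h𝔭
    exact Order.one_le_iff_pos.mpr Module.length_pos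
  have hY : Module.length (Localization.AtPrime 𝔭.asIdeal)
      (LocalizedModule 𝔭.asIdeal.primeCompl
        (X ⧸ (Ideal.span {(P : PowerSeries ℤ_[p])} • ⊤ : Submodule (IwasawaAlgebra p) X))) ≤
      Module.lengthAt (IwasawaAlgebra p) X 𝔭 :=
    length_localizedModule_le_of_surjective 𝔭
      (Submodule.mkQ (Ideal.span {(P : PowerSeries ℤ_[p])} • ⊤ : Submodule (IwasawaAlgebra p) X))
      (Submodule.mkQ_surjective _)
  calc (t : ℕ∞) = t * 1 := (mul_one _).symm
    _ ≤ t * Module.length (Localization.AtPrime 𝔭.asIdeal)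
        (LocalizedModule 𝔭.asIdeal.primeCompl
          (IwasawaAlgebra p ⧸ Ideal.span {(P : PowerSeries ℤ_[p])})) := by gcongr
    _ ≤ _ := hFY
    _ ≤ _ := hY

include hP in
/-- `𝒪 = Λ/(P)` is a free `ℤ_p`-module of rank `deg P` and finite, for a distinguished `P` (Weierstrass division; the tree's
`free_quotient_pow` / `finite_quotient_pow` / `finrank_quotient_pow` at exponent `1`). [cite: Washington1997, Prop. 7.2] -/
theorem free_finite_finrank_quotient_coe :
    Module.Free ℤ_[p] (IwasawaAlgebra p ⧸ Ideal.span {(P : PowerSeries ℤ_[p])}) ∧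
      Module.Finite ℤ_[p] (IwasawaAlgebra p ⧸ Ideal.span {(P : PowerSeries ℤ_[p])}) ∧
      Module.finrank ℤ_[p] (IwasawaAlgebra p ⧸ Ideal.span {(P : PowerSeries ℤ_[p])}) = P.natDegree := by
  have e : Ideal.span {(P : PowerSeries ℤ_[p])} = Ideal.span {((P : ℤ_[p][X]) : IwasawaAlgebra p) ^ 1} := by
    rw [pow_one]
  rw [e]
  exact ⟨free_quotient_pow p hP 1, finite_quotient_pow p hP 1, by rw [finrank_quotient_pow p hP 1, one_mul]⟩

include hP hPr in
/-- ★ **`P^t ∣ g` for `g ∈ char_Λ X`, from `deg P · t` elements of `X` that are `ℤ_p`-independent modulo `P·X`** — for EVERY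
distinguished polynomial `P ∈ ℤ_p[X]` that is prime in `Λ`. For a finitely generated torsion `Λ`-module `X` and `x_1, …, x_m ∈ X`
such that `∑ c_k x_k ∈ P·X` with `c_k ∈ ℤ_p` forces `c = 0`: if `deg P · t ≤ m` then `P^t` divides every element of the
characteristic ideal of `X` (rank conversion turns the `x_k` into `t` elements of `X/P·X` independent over the domain `𝒪 = Λ/(P)`,
free of `ℤ_p`-rank `deg P`; then lengths at `(P)`). In structure-theorem terms (`X ∼ ⊕ Λ/(p^{μ_i}) ⊕ ⊕ Λ/(f_j^{a_j})`):
`rank_{ℤ_p} X/P·X ≥ deg P · #{j : f_j = P}`-many independent elements detect `P^{#{j : f_j = P}} ∣ ∏ f_j^{a_j}`. The tree's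
`xi_pow_dvd_of_mem_charIdeal_of_indep` is `P = ξ_p`. [cite: Washington1997, §13.2] [cite: GreenbergLNM1716, §5 p. 132] -/
theorem coe_pow_dvd_of_mem_charIdeal_of_indep (X : Type u) [AddCommGroup X]
    [Module (IwasawaAlgebra p) X] [Module.Finite (IwasawaAlgebra p) X]
    (hX : Module.IsTorsion (IwasawaAlgebra p) X) {m : ℕ} (x : Fin m → X)
    (hx : ∀ (c : Fin m → ℤ_[p]) (y : X),
      ∑ k, (PowerSeries.C (c k) : IwasawaAlgebra p) • x k = (P : PowerSeries ℤ_[p]) • y → ∀ k, c k = 0)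
    {t : ℕ} (ht : P.natDegree * t ≤ m) {g : IwasawaAlgebra p}
    (hg : g ∈ Module.charIdeal (IwasawaAlgebra p) X) : (P : PowerSeries ℤ_[p]) ^ t ∣ g := by
  classical
  -- the prime `𝔭 = (P)` and the quotient `Y = X / P·X` as a module over `𝒪 = Λ/(P)`
  let 𝔭 : PrimeSpectrum (IwasawaAlgebra p) := ⟨Ideal.span {(P : PowerSeries ℤ_[p])}, isPrime_span_coe hPr⟩
  let Y := X ⧸ (Ideal.span {(P : PowerSeries ℤ_[p])} • ⊤ : Submodule (IwasawaAlgebra p) X)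
  letI : Module ℤ_[p] Y := Module.compHom Y (algebraMap ℤ_[p] (IwasawaAlgebra p))
  haveI : IsScalarTower ℤ_[p] (IwasawaAlgebra p) Y := IsScalarTower.of_compHom ℤ_[p] _ _
  haveI : IsScalarTower ℤ_[p] (IwasawaAlgebra p ⧸ Ideal.span {(P : PowerSeries ℤ_[p])}) Y := inferInstance
  -- the images of the `x_k` are `ℤ_p`-independent in `Y`
  have hli : LinearIndependent ℤ_[p] (fun k ↦ (Submodule.Quotient.mk (x k) : Y)) := by
    rw [Fintype.linearIndependent_iff]
    intro c hc
    have hsum : (Submodule.Quotient.mk (∑ k, (PowerSeries.C (c k) : IwasawaAlgebra p) • x k) : Y) = 0 := by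
      rw [← hc, ← Submodule.mkQ_apply, map_sum]
      refine Finset.sum_congr rfl fun k _ ↦ ?_
      rw [map_smul, Submodule.mkQ_apply]
      change _ = (algebraMap ℤ_[p] (IwasawaAlgebra p) (c k)) • (Submodule.Quotient.mk (x k) : Y)
      rw [PowerSeries.algebraMap_eq]
    rw [Submodule.Quotient.mk_eq_zero, Submodule.ideal_span_singleton_smul,
      Submodule.mem_smul_pointwise_iff_exists] at hsum
    obtain ⟨y, -, hy⟩ := hsum
    exact hx c y hy.symm
  have hrank : ((P.natDegree * t : ℕ) : Cardinal) ≤ Module.rank ℤ_[p] Y :=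
    le_trans (by exact_mod_cast ht) (natCast_le_rank_iff.mpr ⟨_, hli⟩)
  -- rank conversion to `𝒪 = Λ/(P)`
  obtain ⟨hfree, hfin, hrk⟩ := free_finite_finrank_quotient_coe (p := p) hP
  haveI := hfree; haveI := hfin
  haveI : IsDomain (IwasawaAlgebra p ⧸ Ideal.span {(P : PowerSeries ℤ_[p])}) :=
    (Ideal.Quotient.isDomain_iff_prime _).mpr (isPrime_span_coe hPr)
  have hd : Module.rank ℤ_[p] (IwasawaAlgebra p ⧸ Ideal.span {(P : PowerSeries ℤ_[p])}) ≤ (P.natDegree : ℕ) := by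
    rw [← Module.finrank_eq_rank, hrk]
  have hd1 : 1 ≤ P.natDegree := by
    refine Nat.one_le_iff_ne_zero.mpr fun h0 ↦ hPr.not_unit ?_
    rw [(Polynomial.Monic.natDegree_eq_zero hP.monic).mp h0, Polynomial.coe_one]; exact isUnit_one
  obtain ⟨z, hz⟩ := exists_linearIndependent_of_rank_le hd1 hd
    (fun α hα ↦ exists_dvd_algebraMap_of_ne_zero α hα) t Y hrank
  -- lengths
  exact coe_pow_dvd_of_mem_charIdeal_of_le_lengthAt hPr 𝔭 rfl X hX hg
    (natCast_le_lengthAt_of_linearIndependent_coe 𝔭 rfl X hz)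

end General

/-! ## §2 The layer polynomials `Ψ_n = Φ_{p^{n+1}}(1+T)`: degree `pⁿ(p−1)`, height one, geometric-sum and `ω`-relations -/

section Layer

variable (p)

/-- `deg Ψ_n = φ(p^{n+1}) = pⁿ·(p−1)`. [folklore] -/
theorem natDegree_cyclotomicLayer (n : ℕ) :
    ((cyclotomic (p ^ (n + 1)) ℤ_[p]).comp (X + 1)).natDegree = p ^ n * (p - 1) := by
  rw [natDegree_cyclotomic_comp, Nat.totient_prime_pow_succ hp.out n]

/-- `(Ψ_n) ⊂ Λ` is a prime ideal of height one (`Ψ_n` is PRIME in `Λ`: tree `DefectPrime.prime_coe_cyclotomic_comp`, Weierstrass division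
`ℤ_p[X]/(Ψ_n) ≅ Λ/(Ψ_n) ≅ ℤ_p[ζ_{p^{n+1}}]`). [cite: Washington1997, §13.2] -/
theorem isPrime_span_cyclotomicLayer (n : ℕ) :
    (Ideal.span {(((cyclotomic (p ^ (n + 1)) ℤ_[p]).comp (X + 1) : ℤ_[p][X]) : PowerSeries ℤ_[p])}).IsPrime ∧
      (Ideal.span {(((cyclotomic (p ^ (n + 1)) ℤ_[p]).comp (X + 1) : ℤ_[p][X]) : PowerSeries ℤ_[p])}).height = 1 :=
  ⟨isPrime_span_coe (prime_coe_cyclotomic_comp p n), height_span_coe (prime_coe_cyclotomic_comp p n)⟩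

/-- `Ψ_n ≠ 0` in `Λ` and `Ψ_n` is not a unit. [folklore] -/
theorem cyclotomicLayer_ne_zero_and_not_isUnit (n : ℕ) :
    (((cyclotomic (p ^ (n + 1)) ℤ_[p]).comp (X + 1) : ℤ_[p][X]) : PowerSeries ℤ_[p]) ≠ 0 ∧
      ¬ IsUnit (((cyclotomic (p ^ (n + 1)) ℤ_[p]).comp (X + 1) : ℤ_[p][X]) : PowerSeries ℤ_[p]) :=
  ⟨(prime_coe_cyclotomic_comp p n).ne_zero, (prime_coe_cyclotomic_comp p n).not_unit⟩

/-- **`λ(Ψ_n) = pⁿ(p−1)`** (tree `DefectPrime.lam_coe_cyclotomic_comp`: `= φ(p^{n+1})`). [cite: Washington1997, Thm. 7.3] -/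
theorem lam_cyclotomicLayer (n : ℕ) :
    lam ((((cyclotomic (p ^ (n + 1)) ℤ_[p]).comp (X + 1) : ℤ_[p][X]) : PowerSeries ℤ_[p])) = p ^ n * (p - 1) := by
  rw [lam_coe_cyclotomic_comp, Nat.totient_prime_pow_succ hp.out n]

/-- `‖Ψ_n(0)‖ = p⁻¹` (`Ψ_n(0) = Φ_{p^{n+1}}(1) = p`, tree `DefectPrime.constantCoeff_coe_cyclotomic_comp`; `μ(Ψ_n) = 0` is the tree's
`DefectPrime.mu_coe_cyclotomic_comp`). [folklore] -/
theorem norm_constantCoeff_cyclotomicLayer (n : ℕ) :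
    ‖PowerSeries.constantCoeff ((((cyclotomic (p ^ (n + 1)) ℤ_[p]).comp (X + 1) : ℤ_[p][X]) : PowerSeries ℤ_[p]))‖ =
      (p : ℝ)⁻¹ := by
  rw [constantCoeff_coe_cyclotomic_comp, PadicInt.norm_p]

/-- **`Ψ_n = ∑_{i<p} ((1+T)^{pⁿ})^i` in `Λ`** (Mathlib `cyclotomic_prime_pow_eq_geom_sum`): under `1 + T ↔ γ` this is the relative
norm element `∑_{i<p} γ^{pⁿ i}` of `K_{n+1}/K_n`. [cite: Washington1997, §13.2] -/
theorem coe_cyclotomicLayer_eq_sum (n : ℕ) :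
    (((cyclotomic (p ^ (n + 1)) ℤ_[p]).comp (X + 1) : ℤ_[p][X]) : PowerSeries ℤ_[p]) =
      ∑ i ∈ Finset.range p, ((1 + PowerSeries.X : PowerSeries ℤ_[p]) ^ p ^ n) ^ i := by
  have hring : ∀ q : ℤ_[p][X], (q : PowerSeries ℤ_[p]) = (coeToPowerSeries.ringHom : ℤ_[p][X] →+* _) q := fun _ ↦ rfl
  rw [cyclotomic_prime_pow_eq_geom_sum hp.out]
  simp only [Polynomial.comp, Polynomial.eval₂_finsetSum, Polynomial.eval₂_pow, Polynomial.eval₂_X]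
  rw [hring, map_sum]
  simp only [map_pow, map_add, map_one, Polynomial.coeToPowerSeries.ringHom_apply, Polynomial.coe_X, add_comm]

/-- **`Ψ_n · ω_n = ω_{n+1}`**, `ω_n = (1+T)^{pⁿ} − 1` (Mathlib `cyclotomic_prime_pow_mul_X_pow_sub_one` at `1+T`); iterating,
`ω_{n+1} = T · Ψ_0 · Ψ_1 ⋯ Ψ_n`. [cite: Washington1997, §13.2] -/
theorem coe_cyclotomicLayer_mul_omega (n : ℕ) :
    (((cyclotomic (p ^ (n + 1)) ℤ_[p]).comp (X + 1) : ℤ_[p][X]) : PowerSeries ℤ_[p]) *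
        ((1 + PowerSeries.X) ^ p ^ n - 1) = (1 + PowerSeries.X) ^ p ^ (n + 1) - 1 := by
  have h := congr_arg (fun q : ℤ_[p][X] ↦ ((q.comp (X + 1) : ℤ_[p][X]) : PowerSeries ℤ_[p]))
    (cyclotomic_prime_pow_mul_X_pow_sub_one ℤ_[p] p n)
  simp only [mul_comp, sub_comp, pow_comp, X_comp, one_comp, Polynomial.coe_mul, Polynomial.coe_sub, Polynomial.coe_pow,
    Polynomial.coe_add, Polynomial.coe_X, Polynomial.coe_one] at h
  simpa only [add_comm] using h

/-- `Ψ_0 = ξ_p` (the tree's first-layer polynomial `X1.CyclotomicZeros.xi`). [folklore] -/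
theorem coe_cyclotomicLayer_zero :
    (((cyclotomic (p ^ (0 + 1)) ℤ_[p]).comp (X + 1) : ℤ_[p][X]) : PowerSeries ℤ_[p]) = xi p := by
  rw [zero_add, pow_one]; rfl

/-- `𝒪_n = Λ/(Ψ_n)` is free of rank `pⁿ(p−1)` over `ℤ_p` and finite (`≅ ℤ_p[ζ_{p^{n+1}}]`). [cite: Washington1997, Prop. 7.2] -/
theorem free_finite_finrank_quotient_cyclotomicLayer (n : ℕ) :
    Module.Free ℤ_[p] (IwasawaAlgebra p ⧸
        Ideal.span {(((cyclotomic (p ^ (n + 1)) ℤ_[p]).comp (X + 1) : ℤ_[p][X]) : PowerSeries ℤ_[p])}) ∧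
      Module.Finite ℤ_[p] (IwasawaAlgebra p ⧸
        Ideal.span {(((cyclotomic (p ^ (n + 1)) ℤ_[p]).comp (X + 1) : ℤ_[p][X]) : PowerSeries ℤ_[p])}) ∧
      Module.finrank ℤ_[p] (IwasawaAlgebra p ⧸
        Ideal.span {(((cyclotomic (p ^ (n + 1)) ℤ_[p]).comp (X + 1) : ℤ_[p][X]) : PowerSeries ℤ_[p])}) = p ^ n * (p - 1) := by
  rw [← natDegree_cyclotomicLayer p n]
  exact free_finite_finrank_quotient_coe (cyclotomic_comp_isDistinguishedAt_maximalIdeal p n)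

end Layer

/-! ## §3 `Ψ_n^t ∣ char_Λ X` from `pⁿ(p−1)·t` elements of `X` that are `ℤ_p`-independent modulo `Ψ_n·X` -/

section LayerAssembly

variable (p)

/-- ★★ **`Ψ_n^t ∣ g` for every `g ∈ char_Λ X`, from `pⁿ(p−1)·t` elements of `X` that are `ℤ_p`-independent modulo `Ψ_n · X`**
(`Ψ_n = Φ_{p^{n+1}}(1+T)`; `X` a finitely generated torsion `Λ`-module; `x_1, …, x_m ∈ X` with `∑ c_k x_k ∈ Ψ_n X ⇒ c = 0`,
`pⁿ(p−1)·t ≤ m`). The case `n = 0` is the tree's `xi_pow_dvd_of_mem_charIdeal_of_indep`. This is the algebra behind «a jump of the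
Mordell–Weil rank by `φ(p^{n+1})·t` in the layer `K_{n+1}/K_n` puts `Φ_{p^{n+1}}(1+T)^t` into `char_Λ X(E/K_∞)`» (companion file
`…CyclotomicLayerRankGrowth`). [cite: GreenbergLNM1716, §5 p. 132] [cite: Washington1997, §13.2] -/
theorem cyclotomicLayer_pow_dvd_of_mem_charIdeal_of_indep (n : ℕ) (M : Type u) [AddCommGroup M]
    [Module (IwasawaAlgebra p) M] [Module.Finite (IwasawaAlgebra p) M]
    (hM : Module.IsTorsion (IwasawaAlgebra p) M) {m : ℕ} (x : Fin m → M)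
    (hx : ∀ (c : Fin m → ℤ_[p]) (y : M),
      ∑ k, (PowerSeries.C (c k) : IwasawaAlgebra p) • x k =
        (((cyclotomic (p ^ (n + 1)) ℤ_[p]).comp (X + 1) : ℤ_[p][X]) : PowerSeries ℤ_[p]) • y → ∀ k, c k = 0)
    {t : ℕ} (ht : p ^ n * (p - 1) * t ≤ m) {g : IwasawaAlgebra p}
    (hg : g ∈ Module.charIdeal (IwasawaAlgebra p) M) :
    (((cyclotomic (p ^ (n + 1)) ℤ_[p]).comp (X + 1) : ℤ_[p][X]) : PowerSeries ℤ_[p]) ^ t ∣ g :=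
  coe_pow_dvd_of_mem_charIdeal_of_indep (cyclotomic_comp_isDistinguishedAt_maximalIdeal p n) (prime_coe_cyclotomic_comp p n) M hM x hx
    (by rwa [natDegree_cyclotomicLayer]) hg

/-- `t = 1`: `pⁿ(p−1)` independent elements modulo `Ψ_n X` put `Ψ_n` into `char_Λ X`. [cite: GreenbergLNM1716, §5 p. 132] -/
theorem cyclotomicLayer_dvd_of_mem_charIdeal_of_indep (n : ℕ) (M : Type u) [AddCommGroup M]
    [Module (IwasawaAlgebra p) M] [Module.Finite (IwasawaAlgebra p) M]
    (hM : Module.IsTorsion (IwasawaAlgebra p) M) {m : ℕ} (x : Fin m → M)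
    (hx : ∀ (c : Fin m → ℤ_[p]) (y : M),
      ∑ k, (PowerSeries.C (c k) : IwasawaAlgebra p) • x k =
        (((cyclotomic (p ^ (n + 1)) ℤ_[p]).comp (X + 1) : ℤ_[p][X]) : PowerSeries ℤ_[p]) • y → ∀ k, c k = 0)
    (hm : p ^ n * (p - 1) ≤ m) {g : IwasawaAlgebra p}
    (hg : g ∈ Module.charIdeal (IwasawaAlgebra p) M) :
    (((cyclotomic (p ^ (n + 1)) ℤ_[p]).comp (X + 1) : ℤ_[p][X]) : PowerSeries ℤ_[p]) ∣ g := by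
  simpa using cyclotomicLayer_pow_dvd_of_mem_charIdeal_of_indep p n M hM x hx (t := 1) (by simpa using hm) hg

end LayerAssembly

end Summit.BirchSwinnertonDyer.BirchSwinnertonDyer.Theorems.AlignedTransportAtTwoCyclotomicLayerPrime
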